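import Summits.BirchSwinnertonDyer.Rank1Residual.X11b.Three.JetchevKummerLink
import Literature.NumberTheory.EllipticCurves.Jetchev2008.SelmerStructures
import HarnessLib

/-!
# T1 JET (cell `bsd-jet`), road K: the STRINGENT family `𝒮` of [J] §3.1 / Def. 4.8 as a
# `SelmerStructure` (the parameter `𝒮` of `Jetchev2008.selmerF0` and of
# `JET.tamagawaExponent_le_mInfty_of_rowData`), instantiated on x11b3's connected Kummer condition

HONEST FRAMING (programme file §HONESTY, verbatim): «no tranche here proves BSD; ARM L moves the
LITERAL column of an r ≤ 1 census into the kernel-proved-modulo-named-print column.» Seat `bsd-jet-pv-2`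
(session g2); route-posited DEFINITION + its two lemmas; 0 classes move. The Literature vocabulary
`Jetchev2008.selmerF0 W n 𝒯 𝒮 S Q` (p486185) takes the stringent family `𝒮` as a parameter because the
intended value — x11b3's `X11b.Three.JetchevKummer.connectedKummerCondition` (`H¹_{Kum⁰} = δ(E₀(K_v))`,
[J] printed §3.1) — is Summits-side and needs the minimality of the model over the valuation ring of
`K_v` as an instance. Here: `JET.stringentFamily W K n hn`, the Selmer structure on `E[n]/K` which at a
finite place `𝔮` is the connected Kummer condition at `K_𝔮 = 𝔮.adicCompletion K` over
`𝔮.adicCompletionIntegers K` WHEN the base-changed model is minimal there (classical `dite`), and the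
Kummer condition otherwise (also at the infinite places); `stringentFamily_le_kummer` = the hypothesis
`hS` of `JET.tamagawaExponent_le_mInfty_of_rowData` (p492296); `stringentFamily_inr_of_isMinimal` =
unfolding. References: [cite: Jetchev2008, §3.1 (p. 814) and §3.3.2 (p. 816) = arXiv §4.1 item 4, Def. 4.8].
-/

set_option autoImplicit false

noncomputable section

open scoped Classical

open WeierstrassCurve IsDedekindDomain NumberField Literature.NumberTheory.EllipticCurves
  Literature.NumberTheory.GaloisRepresentations
  Literature.NumberTheory.GaloisRepresentations.DiscreteGaloisModule

namespace Summit.BirchSwinnertonDyer.Rank1Residual.JET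

variable (W : WeierstrassCurve ℚ) [W.IsElliptic] (K : Type) [Field K] [NumberField K]
  {n : ℤ} (hn : n ≠ 0)

/-- **The stringent family `𝒮`** ([J] printed §3.1, the connected Kummer condition
`H¹_{Kum⁰}(K_v, E[n]) = δ_v(E⁰(K_v))`, as a Selmer structure on `E[n]/K`): at a finite place `𝔮` where
the model `W/K_𝔮` is minimal over `𝓞_{K_𝔮} = 𝔮.adicCompletionIntegers K`, x11b3's
`connectedKummerCondition (W⁄K) K_𝔮 𝓞_{K_𝔮} hn`; elsewhere (non-minimal places, never used as stringent
places; infinite places) the Kummer condition. The intended use is `Jetchev2008.selmerF0 W n 𝒯 𝒮 S Q` with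
`Q` = the places above the carrier, where a globally minimal `W/ℚ` base-changed to the unramified `K_𝔮`
is minimal. [cite: Jetchev2008, §3.1 (p. 814), §3.3.2 (p. 816)] -/
def stringentFamily : SelmerStructure ((W.baseChange K).torsionGaloisModule n) := fun v ↦
  match v with
  | Sum.inl w => (W.baseChange K).kummerSelmerStructure n (Sum.inl w)
  | Sum.inr q =>
    if h : ((W.baseChange K).baseChange (q.adicCompletion K)).IsMinimal (q.adicCompletionIntegers K) then
      by
        haveI := h
        exact X11b.Three.JetchevKummer.connectedKummerCondition (W.baseChange K) (q.adicCompletion K)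
          (q.adicCompletionIntegers K) hn
    else (W.baseChange K).kummerSelmerStructure n (Sum.inr q)

/-- At a finite place where the model is minimal, the stringent family IS the connected Kummer
condition. [cite: Jetchev2008, §3.1 (p. 814)] -/
theorem stringentFamily_inr_of_isMinimal (q : HeightOneSpectrum (𝓞 K))
    [h : ((W.baseChange K).baseChange (q.adicCompletion K)).IsMinimal (q.adicCompletionIntegers K)] :
    stringentFamily W K hn (Sum.inr q) =
      X11b.Three.JetchevKummer.connectedKummerCondition (W.baseChange K) (q.adicCompletion K)
        (q.adicCompletionIntegers K) hn := by
  simp only [stringentFamily, dif_pos h]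

/-- **`𝒮 ≤ 𝓕` (stringent refines Kummer) at every place** — the hypothesis `hS` of
`JET.tamagawaExponent_le_mInfty_of_rowData`; from x11b3's
`connectedKummerCondition_le_kummerLocalConditionAt`. [cite: Jetchev2008, §3.1 (p. 814)] -/
theorem stringentFamily_le_kummer (v : Place K) :
    stringentFamily W K hn v ≤ (W.baseChange K).kummerSelmerStructure n v := by
  rcases v with w | q
  · exact le_rfl
  · by_cases h : ((W.baseChange K).baseChange (q.adicCompletion K)).IsMinimal (q.adicCompletionIntegers K)
    · simp only [stringentFamily, dif_pos h]
      exact X11b.Three.JetchevKummer.connectedKummerCondition_le_kummerLocalConditionAt (W.baseChange K)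
        (q.adicCompletion K) (q.adicCompletionIntegers K) hn
    · simp only [stringentFamily, dif_neg h]
      exact le_rfl

end Summit.BirchSwinnertonDyer.Rank1Residual.JET

end
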